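import Literature.AnabelianGeometry.SemiGraphs.TemperedReconstructionGraphLevel
import Literature.AnabelianGeometry.SemiGraphs.TemperedReconstructionGraphHomProofsAt
import Literature.AnabelianGeometry.SemiGraphs.TemperedReconstructionVertexMapProofsAt
import Literature.AnabelianGeometry.SemiGraphs.TemperedReconstructionEdgeMapProofsAt
import Literature.AnabelianGeometry.SemiGraphs.TemperedThm37OfCompactInVerticialAt
import HarnessLib

/-!
# Corollary 3.9 (b) at the level of underlying graphs, compatible reading — AT ONE PAIR OF GRAPHS
# (φ2 twin)

Mochizuki, *Semi-graphs of anabelioids*, Publ. RIMS **42** (2006), §3, Definition 3.8 / Corollary 3.9,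
manuscript pp. 42–43 [cite: MochizukiSemiAnbd2006, Cor 3.9 pp.42-43].

Companion of `TemperedReconstructionGraphLevel.lean` (abc-iut-L3-t2) under the cell's φ2-consumers
programme (rulings φ2 / α4-3 / α5-3 of abc-iut-L3-lead): `exists_semiGraphHom_of_isCompatiblyQuasi
Geometric` is re-proved VERBATIM with the per-graph hypotheses `(h𝒢iii : CompactInVerticialAt 𝒢)`,
`(hℋiii : CompactInVerticialAt ℋ)` (abc-iut-w4-d075, `TemperedCompactInVerticialAt.lean`) in place of the
∀-countable named fact `CompactInVerticial` — two-graph rule: Thm. 3.7 (iv) is needed at BOTH graphs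
(maximal compact ⇒ verticial on the source side, verticial ⇒ maximal compact on the target side), (iii)
itself and `EdgeLikeDistinct` at `ℋ`.  Inputs by name: abc-iut-w4-d075's per-graph reductions
(`TemperedThm37OfCompactInVerticialAt.lean`) and abc-iut-L3-d1's per-graph vertex map / edge map /
graph-morphism steps (`…VertexMapProofsAt`, `…EdgeMapProofsAt`, `…GraphHomProofsAt`).  Proof-only; the
original file is untouched.  Nothing here takes a side on [IUTchIII] Cor. 3.12; typed ≠ discharged.
-/

namespace Literature.AnabelianGeometry.SemiGraphs

namespace ProfiniteSemiGraph

universe u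

variable {𝒢 ℋ : ProfiniteSemiGraph.{u}}

/-- **Cor. 3.9 (b), graph level, compatible reading, per-graph form** of
`exists_semiGraphHom_of_isCompatiblyQuasiGeometric`: a compatibly quasi-geometric `φ` determines a
morphism of underlying graphs carrying verticial (resp. edge-like) subgroups onto open subgroups of
verticial (resp. edge-like) subgroups at the image vertex (resp. edge) — Thm. 3.7 (iii) AT `𝒢` and AT
`ℋ`. [cite: MochizukiSemiAnbd2006, Cor 3.9 p.42] -/
theorem exists_semiGraphHom_of_isCompatiblyQuasiGeometricAt (h37i : VerticialInjective.{u})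
    (h𝒢iii : CompactInVerticialAt 𝒢) (hℋiii : CompactInVerticialAt ℋ) (h𝒢 : Cor39Hypotheses 𝒢)
    (hℋ : Cor39Hypotheses ℋ) (c𝒢 : TemperedPiChart 𝒢) (cℋ : TemperedPiChart ℋ) (φ : c𝒢.G →ₜ* cℋ.G)
    (hφ : IsCompatiblyQuasiGeometric φ) :
    ∃ F : SemiGraph.Hom 𝒢.graph ℋ.graph,
      (∀ (v : 𝒢.graph.Vertex) (K : Subgroup c𝒢.G), K ∈ verticialSubgroups c𝒢 v →
        ∃ K₂ ∈ verticialSubgroups cℋ (F.vertexMap v), MapsOntoOpenSubgroupOf φ.toMonoidHom K K₂) ∧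
      ∀ (e : 𝒢.graph.Edge) (L : Subgroup c𝒢.G), L ∈ edgeLikeSubgroups c𝒢 e →
        ∃ L₂ ∈ edgeLikeSubgroups cℋ (F.edgeMap e), MapsOntoOpenSubgroupOf φ.toMonoidHom L L₂ := by
  have h37iv𝒢 : MaximalCompactIffVerticialAt 𝒢 := maximalCompactIffVerticialAt_of_compactInVerticialAt h𝒢iii
  have h37ivℋ : MaximalCompactIffVerticialAt ℋ := maximalCompactIffVerticialAt_of_compactInVerticialAt hℋiii
  have hED : EdgeLikeDistinctAt ℋ := edgeLikeDistinctAt_of_compactInVerticialAt hℋiii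
  obtain ⟨fV, hfV, -⟩ := existsUnique_vertexMap_of_isQuasiGeometric_at h37i verticialDistinct_holds
    h37iv𝒢 h37ivℋ h𝒢.thm37Hypotheses hℋ.thm37Hypotheses c𝒢 cℋ φ hφ.isQuasiGeometric
  obtain ⟨fE, hfE, -⟩ := existsUnique_edgeMap_of_isQuasiGeometric_at h37i h37iv𝒢 h37ivℋ hED h𝒢 hℋ
    c𝒢 cℋ φ hφ.isQuasiGeometric
  obtain ⟨F, hFV, hFE⟩ := exists_semiGraphHom_of_isQuasiGeometric_at h37i hℋiii h37iv𝒢 h37ivℋ h𝒢 hℋ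
    c𝒢 cℋ φ hφ.compat hfV hfE
  subst hFV hFE
  exact ⟨F, hfV, hfE⟩

end ProfiniteSemiGraph

end Literature.AnabelianGeometry.SemiGraphs
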